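import Mathlib
import Summits.Ventures.PercRepro2.CoinFunctionalDefs
import Summits.Ventures.PercRepro2.CoinFunctionalReduce
import Summits.Ventures.PercRepro2.CoinLsmHead
import Summits.Ventures.PercRepro2.CoinForestLaw
import Summits.Ventures.PercRepro2.CoinForestHead

/-!
# Row 2′DARC at lsm heads and forest heads — FUNCTIONAL FORM (blind cell PercRepro2,
night-2 g5; proofs/NIGHT2-DARC.md §27, §22.1′)

`darcF_of_lsmHead_mixed` and `darcF_of_forestHead_mixed`: `darc_of_lsmHead_mixed` /
`darc_of_forestHead_mixed` for a pair of increasing `[0, 1]`-valued cluster functionals `F₁, F₂`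
blind to `P ∪ {t}` — the same proof with the marker masses `G S = P(R_{S ∪ {t}}) − E[F₁; R_{S ∪ {t}}]`
(`shiftF`), through `darcF_of_trace_functional`.
-/

namespace Summit.Ventures.PercRepro2.Coin

section LsmHeadF

open Classical

variable {V : Type*} {E : Type*} [Fintype V] [DecidableEq V] [Fintype E] [DecidableEq E]
  {R : Type*} [Field R] [LinearOrder R] [IsStrictOrderedRing R]

/-- **THEOREM (row 2′DARC at every head with a log-supermodular sub-head trace law, FUNCTIONAL
FORM):** for increasing `[0, 1]`-valued cluster functionals `F₁, F₂` blind to `P ∪ {t}`. -/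
theorem darcF_of_lsmHead_mixed (p : E → R) (hp : IsProbVec p) {arcs : E → Finset (V × V)}
    (hS : SameEnds arcs) (s u w t : V) (Vs : Finset V) (hwV : w ∉ Vs) (hwt : w ≠ t)
    (hclosed : ClosedOut arcs (insert w Vs) {t}) (hT : TailCoinsIn arcs (insert w Vs) {t})
    (A : Finset V) (hAV : A ⊆ Vs) {c : V → E} (hc : ∀ v ∈ A, arcs (c v) = {(w, v)})
    (honlyw : ∀ e, (∃ xy ∈ arcs e, xy.1 = w) → ∃ v ∈ A, e = c v)
    (hnoback : ∀ e, ∀ xy ∈ arcs e, xy.1 ∈ Vs → xy.2 ≠ w)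
    (hβ : ∀ L L', L ⊆ Vs → L' ⊆ Vs →
      prob p (traceLevel arcs {t} Vs L) * prob p (traceLevel arcs {t} Vs L') ≤
        prob p (traceLevel arcs {t} Vs (L ∩ L')) * prob p (traceLevel arcs {t} Vs (L ∪ L')))
    {F₁ F₂ : Set V → R} (hF₁ : Monotone F₁) (hF₂ : Monotone F₂) (hF₁0 : ∀ S, 0 ≤ F₁ S)
    (hF₂0 : ∀ S, 0 ≤ F₂ S) (hF₁1 : ∀ S, F₁ S ≤ 1) (hF₂1 : ∀ S, F₂ S ≤ 1)
    (hF₁b : ∀ S : Set V, F₁ (S \ ↑(insert w Vs ∪ {t})) = F₁ S)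
    (hF₂b : ∀ S : Set V, F₂ (S \ ↑(insert w Vs ∪ {t})) = F₂ S) (hu : u ∉ insert w Vs ∪ {t})
    (hP : ∀ Z ∈ (insert w Vs).powerset,
      0 < prob p (avoidEvent (arcsOff arcs (insert w Vs ∪ {t})) s (Z ∪ {t})))
    (hQ : ∀ Z ∈ (insert w Vs).powerset,
      0 < prob p (avoidEvent (arcsOff arcs (insert w Vs ∪ {t})) s (gateTarget u w Z {t}))) :
    DARCF p arcs s {t} F₁ F₂ u w := by
  have hwP : w ∈ insert w Vs := Finset.mem_insert_self w Vs
  have hS₀ : SameEnds (arcsOff arcs (insert w Vs ∪ {t})) := sameEnds_arcsOff hS _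
  refine darcF_of_trace_functional p hp hS hclosed hT s u w hwP hF₁ hF₂ hF₁0 hF₂0 hF₁b hF₂b hu
    hQ ?_
  -- the avoidance function of the reduced system and the trace data
  set D₀ := arcsOff arcs (insert w Vs ∪ {t}) with hD₀
  set X₀ : Config E → R := fun ω => F₁ (clusterC D₀ ω s) with hX₀
  set Y₀ : Config E → R := fun ω => F₂ (clusterC D₀ ω s) with hY₀
  set F : Finset V → R := fun S => prob p (avoidEvent D₀ s (S ∪ {t})) with hF
  set ℓ : Finset V → R := fun Z => prob p (traceLevel arcs {t} (insert w Vs) Z) with hℓ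
  set Qz : Finset V → R := fun Z => prob p (avoidEvent D₀ s (gateTarget u w Z {t})) with hQz
  set Az : Finset V → R := fun Z => massE p X₀ (avoidEvent D₀ s (Z ∪ {t})) with hAz
  set Bz : Finset V → R := fun Z => massE p Y₀ (avoidEvent D₀ s (Z ∪ {t})) with hBz
  set Ahz : Finset V → R := fun Z => massE p X₀ (avoidEvent D₀ s (gateTarget u w Z {t})) with hAhz
  set Bhz : Finset V → R := fun Z => massE p Y₀ (avoidEvent D₀ s (gateTarget u w Z {t})) with hBhz
  set β : Finset V → R := fun L => prob p (traceLevel arcs {t} Vs L) with hβdef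
  set q : V → R := fun v => if v ∈ A then 1 - p (c v) else 1 with hq
  set Ga : Finset V → R := fun S => F S - Az S with hGa
  set Gb : Finset V → R := fun S => F S - Bz S with hGb
  show 0 ≤ ∑ Z ∈ (insert w Vs).powerset, ℓ Z * Qz Z *
      (Ahz Z / Qz Z * (∑ Z' ∈ (insert w Vs).powerset, ℓ Z' * F Z') -
        ∑ Z' ∈ (insert w Vs).powerset, ℓ Z' * Az Z') *
      (Bhz Z / Qz Z * (∑ Z' ∈ (insert w Vs).powerset, ℓ Z' * F Z') -
        ∑ Z' ∈ (insert w Vs).powerset, ℓ Z' * Bz Z')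
  -- membership facts
  have huV : u ∉ Vs := fun h => hu (Finset.mem_union_left _ (Finset.mem_insert_of_mem h))
  have hwu : w ≠ u := fun h => hu (Finset.mem_union_left _ (h ▸ hwP))
  have hwnotin : ∀ L ⊆ Vs, w ∉ L := fun L hL h => hwV (hL h)
  have hLP : ∀ L ⊆ Vs, L ∈ (insert w Vs).powerset := fun L hL =>
    Finset.mem_powerset.mpr (hL.trans (Finset.subset_insert w Vs))
  have hwLP : ∀ L ⊆ Vs, insert w L ∈ (insert w Vs).powerset := fun L hL =>
    Finset.mem_powerset.mpr (Finset.insert_subset_insert w hL)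
  -- the hypotheses of the abstract lemma
  have hF0 : ∀ S, 0 ≤ F S := fun S => prob_nonneg hp _
  have hFdec : ∀ S S', S ⊆ S' → F S' ≤ F S := fun S S' h =>
    prob_mono hp (avoidEvent_anti _ _ (Finset.union_subset_union_left h))
  have hFlsm : ∀ S S', F S * F S' ≤ F (S ∩ S') * F (S ∪ S') := fun S S' => by
    have h := prob_avoid_lsm p hp hS₀ s (S ∪ {t}) (S' ∪ {t})
    rwa [union_singleton_inter, union_singleton_union] at h
  have hFpos : ∀ L ⊆ Vs, 0 < F L := fun L hL => hP L (hLP L hL)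
  have hgate_w : ∀ L : Finset V, gateTarget u w (insert w L) {t} = insert u (insert w L) ∪ {t} := by
    intro L
    rw [gateTarget_of_mem (Finset.mem_insert_self w L)]
    simp only [Finset.insert_union]
  have hFposwu : ∀ L ⊆ Vs, 0 < F (insert u (insert w L)) := fun L hL => by
    have h := hQ (insert w L) (hwLP L hL)
    rwa [hgate_w L] at h
  have hβ0 : ∀ L ⊆ Vs, 0 ≤ β L := fun L _ => prob_nonneg hp _
  have hq0 : ∀ i ∈ Vs, 0 ≤ q i := fun i _ => by
    show 0 ≤ (if i ∈ A then 1 - p (c i) else 1)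
    split_ifs
    · linarith [hp.le_one (c i)]
    · exact zero_le_one
  have hq1 : ∀ i ∈ Vs, q i ≤ 1 := fun i _ => by
    show (if i ∈ A then 1 - p (c i) else 1) ≤ 1
    split_ifs
    · linarith [hp.nonneg (c i)]
    · exact le_rfl
  have hGa0 : ∀ S, 0 ≤ Ga S := fun S => by
    show 0 ≤ prob p (avoidEvent D₀ s (S ∪ {t})) - massE p X₀ (avoidEvent D₀ s (S ∪ {t}))
    linarith [massE_le_prob_of_le_one p hp (f := X₀) (fun ω => hF₁1 _) (avoidEvent D₀ s (S ∪ {t}))]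
  have hGb0 : ∀ S, 0 ≤ Gb S := fun S => by
    show 0 ≤ prob p (avoidEvent D₀ s (S ∪ {t})) - massE p Y₀ (avoidEvent D₀ s (S ∪ {t}))
    linarith [massE_le_prob_of_le_one p hp (f := Y₀) (fun ω => hF₂1 _) (avoidEvent D₀ s (S ∪ {t}))]
  have hGam : ∀ S S', S ⊆ S' → Ga S * F S' ≤ Ga S' * F S := fun S S' h => by
    have hsh := shiftF p hp hS₀ s hF₁ hF₁0 (Finset.union_subset_union_left h : S ∪ {t} ⊆ S' ∪ {t})
    show (prob p (avoidEvent D₀ s (S ∪ {t})) - massE p X₀ (avoidEvent D₀ s (S ∪ {t}))) *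
        prob p (avoidEvent D₀ s (S' ∪ {t})) ≤
      (prob p (avoidEvent D₀ s (S' ∪ {t})) - massE p X₀ (avoidEvent D₀ s (S' ∪ {t}))) *
        prob p (avoidEvent D₀ s (S ∪ {t}))
    nlinarith [hsh]
  have hGbm : ∀ S S', S ⊆ S' → Gb S * F S' ≤ Gb S' * F S := fun S S' h => by
    have hsh := shiftF p hp hS₀ s hF₂ hF₂0 (Finset.union_subset_union_left h : S ∪ {t} ⊆ S' ∪ {t})
    show (prob p (avoidEvent D₀ s (S ∪ {t})) - massE p Y₀ (avoidEvent D₀ s (S ∪ {t}))) *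
        prob p (avoidEvent D₀ s (S' ∪ {t})) ≤
      (prob p (avoidEvent D₀ s (S' ∪ {t})) - massE p Y₀ (avoidEvent D₀ s (S' ∪ {t}))) *
        prob p (avoidEvent D₀ s (S ∪ {t}))
    nlinarith [hsh]
  -- the trace data in terms of `F`, `kA`, `kB`
  have hℓL : ∀ L ⊆ Vs, ℓ L = hA β q L := fun L hL =>
    prob_traceLevel_lsmHead_notMem p hwV hwt hAV hclosed hc honlyw hnoback hL
  have hℓw : ∀ L ⊆ Vs, ℓ (insert w L) = hB β q L := fun L hL =>
    prob_traceLevel_lsmHead_mem p hwV hwt hAV hclosed hc honlyw hnoback hL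
  have hQL : ∀ L ⊆ Vs, Qz L = F L := fun L hL => by
    show prob p (avoidEvent D₀ s (gateTarget u w L {t})) = prob p (avoidEvent D₀ s (L ∪ {t}))
    rw [gateTarget_of_notMem (hwnotin L hL)]
  have hQw : ∀ L : Finset V, Qz (insert w L) = F (insert u (insert w L)) := fun L => by
    show prob p (avoidEvent D₀ s (gateTarget u w (insert w L) {t})) = _
    rw [hgate_w L]
  have hAzF : ∀ Z, Az Z = F Z - Ga Z := fun Z => by
    show Az Z = F Z - (F Z - Az Z); ring
  have hBzF : ∀ Z, Bz Z = F Z - Gb Z := fun Z => by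
    show Bz Z = F Z - (F Z - Bz Z); ring
  have hAhzL : ∀ L ⊆ Vs, Ahz L = F L - Ga L := fun L hL => by
    show massE p X₀ (avoidEvent D₀ s (gateTarget u w L {t})) =
      F L - (F L - massE p X₀ (avoidEvent D₀ s (L ∪ {t})))
    rw [gateTarget_of_notMem (hwnotin L hL)]; ring
  have hBhzL : ∀ L ⊆ Vs, Bhz L = F L - Gb L := fun L hL => by
    show massE p Y₀ (avoidEvent D₀ s (gateTarget u w L {t})) =
      F L - (F L - massE p Y₀ (avoidEvent D₀ s (L ∪ {t})))
    rw [gateTarget_of_notMem (hwnotin L hL)]; ring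
  have hAhzw : ∀ L : Finset V,
      Ahz (insert w L) = F (insert u (insert w L)) - Ga (insert u (insert w L)) :=
    fun L => by
      show massE p X₀ (avoidEvent D₀ s (gateTarget u w (insert w L) {t})) =
        F (insert u (insert w L)) -
          (F (insert u (insert w L)) - massE p X₀ (avoidEvent D₀ s (insert u (insert w L) ∪ {t})))
      rw [hgate_w L]; ring
  have hBhzw : ∀ L : Finset V,
      Bhz (insert w L) = F (insert u (insert w L)) - Gb (insert u (insert w L)) :=
    fun L => by
      show massE p Y₀ (avoidEvent D₀ s (gateTarget u w (insert w L) {t})) =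
        F (insert u (insert w L)) -
          (F (insert u (insert w L)) - massE p Y₀ (avoidEvent D₀ s (insert u (insert w L) ∪ {t})))
      rw [hgate_w L]; ring
  -- from here on the marker masses are opaque
  clear_value Ga Gb
  -- splitting the powerset of `insert w Vs`
  have hsplit : ∀ g : Finset V → R, ∑ Z ∈ (insert w Vs).powerset, g Z =
      ∑ L ∈ Vs.powerset, g L + ∑ L ∈ Vs.powerset, g (insert w L) := fun g => by
    have h := sum_powerset_split (Vs := insert w Vs) (i := w) hwP g
    rwa [Finset.erase_insert hwV] at h
  -- the total mass and the marker masses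
  have eΛ : ∑ Z' ∈ (insert w Vs).powerset, ℓ Z' * F Z' = hLam Vs β q w F := by
    rw [hsplit, hLam, ← Finset.sum_add_distrib]
    refine Finset.sum_congr rfl fun L hL => ?_
    rw [hℓL L (Finset.mem_powerset.mp hL), hℓw L (Finset.mem_powerset.mp hL)]
  have eMX : ∑ Z' ∈ (insert w Vs).powerset, ℓ Z' * Az Z' = hLam Vs β q w F - hMass Vs β q w Ga := by
    rw [← eΛ, hsplit, hsplit, hMass, ← Finset.sum_add_distrib, ← Finset.sum_add_distrib,
      ← Finset.sum_sub_distrib]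
    refine Finset.sum_congr rfl fun L hL => ?_
    rw [hAzF, hAzF, hℓL L (Finset.mem_powerset.mp hL), hℓw L (Finset.mem_powerset.mp hL)]
    ring
  have eMY : ∑ Z' ∈ (insert w Vs).powerset, ℓ Z' * Bz Z' = hLam Vs β q w F - hMass Vs β q w Gb := by
    rw [← eΛ, hsplit, hsplit, hMass, ← Finset.sum_add_distrib, ← Finset.sum_add_distrib,
      ← Finset.sum_sub_distrib]
    refine Finset.sum_congr rfl fun L hL => ?_
    rw [hBzF, hBzF, hℓL L (Finset.mem_powerset.mp hL), hℓw L (Finset.mem_powerset.mp hL)]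
    ring
  rw [eΛ, eMX, eMY, hsplit]
  -- the two kinds of traces
  have e₁ : ∑ L ∈ Vs.powerset, ℓ L * Qz L *
      (Ahz L / Qz L * hLam Vs β q w F - (hLam Vs β q w F - hMass Vs β q w Ga)) *
      (Bhz L / Qz L * hLam Vs β q w F - (hLam Vs β q w F - hMass Vs β q w Gb)) =
      ∑ L ∈ Vs.powerset, hA β q L * F L *
        (Ga L / F L * hLam Vs β q w F - hMass Vs β q w Ga) *
        (Gb L / F L * hLam Vs β q w F - hMass Vs β q w Gb) := by
    refine Finset.sum_congr rfl fun L hL => ?_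
    have hL := Finset.mem_powerset.mp hL
    have hne := (hFpos L hL).ne'
    rw [hℓL L hL, hQL L hL, hAhzL L hL, hBhzL L hL, sub_div, div_self hne, sub_div, div_self hne]
    ring
  have e₂ : ∑ L ∈ Vs.powerset, ℓ (insert w L) * Qz (insert w L) *
      (Ahz (insert w L) / Qz (insert w L) * hLam Vs β q w F -
        (hLam Vs β q w F - hMass Vs β q w Ga)) *
      (Bhz (insert w L) / Qz (insert w L) * hLam Vs β q w F -
        (hLam Vs β q w F - hMass Vs β q w Gb)) =
      ∑ L ∈ Vs.powerset, hB β q L * F (insert u (insert w L)) *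
        (Ga (insert u (insert w L)) / F (insert u (insert w L)) * hLam Vs β q w F -
          hMass Vs β q w Ga) *
        (Gb (insert u (insert w L)) / F (insert u (insert w L)) * hLam Vs β q w F -
          hMass Vs β q w Gb) := by
    refine Finset.sum_congr rfl fun L hL => ?_
    have hL := Finset.mem_powerset.mp hL
    have hne := (hFposwu L hL).ne'
    rw [hℓw L hL, hQw L, hAhzw L, hBhzw L, sub_div, div_self hne, sub_div, div_self hne]
    ring
  rw [e₁, e₂]
  exact lsmHead_functional_nonneg Vs w u hwV huV hwu F Ga Gb hF0 hFdec hFlsm hFpos hFposwu hGa0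
    hGb0 hGam hGbm β hβ0 hβ q hq0 hq1


/-- **THEOREM (row 2′DARC at every forest head, FUNCTIONAL FORM).** -/
theorem darcF_of_forestHead_mixed (p : E → R) (hp : IsProbVec p) {arcs : E → Finset (V × V)}
    (hS : SameEnds arcs) (s u w t : V) (Vs : Finset V) (hwV : w ∉ Vs) (htV : t ∉ Vs)
    (hwt : w ≠ t) (A : Finset V) (hAV : A ⊆ Vs) {c d : V → E} {par : V → V}
    (hc : ∀ v ∈ A, arcs (c v) = {(w, v)})
    (hd : ∀ v ∈ Vs, arcs (d v) = {(v, par v)}) (hpar : ∀ v ∈ Vs, par v ∈ Vs ∨ par v = t)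
    (honly : OnlyForestCoins arcs w A Vs c d) {rk : V → ℕ}
    (hrk : ∀ v ∈ Vs, par v ∈ Vs → rk (par v) < rk v)
    {F₁ F₂ : Set V → R} (hF₁ : Monotone F₁) (hF₂ : Monotone F₂) (hF₁0 : ∀ S, 0 ≤ F₁ S)
    (hF₂0 : ∀ S, 0 ≤ F₂ S) (hF₁1 : ∀ S, F₁ S ≤ 1) (hF₂1 : ∀ S, F₂ S ≤ 1)
    (hF₁b : ∀ S : Set V, F₁ (S \ ↑(insert w Vs ∪ {t})) = F₁ S)
    (hF₂b : ∀ S : Set V, F₂ (S \ ↑(insert w Vs ∪ {t})) = F₂ S) (hu : u ∉ insert w Vs ∪ {t})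
    (hP : ∀ Z ∈ (insert w Vs).powerset,
      0 < prob p (avoidEvent (arcsOff arcs (insert w Vs ∪ {t})) s (Z ∪ {t})))
    (hQ : ∀ Z ∈ (insert w Vs).powerset,
      0 < prob p (avoidEvent (arcsOff arcs (insert w Vs ∪ {t})) s (gateTarget u w Z {t}))) :
    DARCF p arcs s {t} F₁ F₂ u w :=
  darcF_of_lsmHead_mixed p hp hS s u w t Vs hwV hwt (forest_closedOut hAV hc hd hpar honly)
    (forest_tailCoinsIn hc hd honly) A hAV hc (forest_onlyw hwV hc hd honly)
    (forest_noback hwV hwt hc hd hpar honly)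
    (forest_trace_lsm p hp htV hd hpar (forest_onlyForest hwV hc hd honly) hrk) hF₁ hF₂ hF₁0 hF₂0
    hF₁1 hF₂1 hF₁b hF₂b hu hP hQ

end LsmHeadF

end Summit.Ventures.PercRepro2.Coin
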